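import Summits.BirchSwinnertonDyer.Rank1Residual.F1Sign2.SymbolLineTransferAtTwoSigmaS3
import Literature.NumberTheory.EllipticCurves.GreenbergVatsal2000.EulerFactorDepletion
import HarnessLib

/-!
# Cell `bsd-f1-sign2`, lens `-imc`: IMC-SYMB-Σ pushed down to RATIONAL MODULAR SYMBOLS — `SigmaDepletedSymbolParityAtTwoS3`, the
# Σ-SYMBOL PARITY LAW on the `2`-power cusps for aligned good-ordinary `S₃` pairs (filed by -ty g7 on the lead prover's ONE filing ask)

STATEMENT ONLY (ONE `@[conjecture] def` = open obligation — a conjecture of OURS, not a published result; nothing asserted; no theorem, no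
named Literature fact, no `sorry`). A SIBLING file of `SymbolLineTransferAtTwoSigmaS3.lean` (IMC-SYMB-Σ(S₃) / RawS3) rather than an append,
because the body needs `GreenbergVatsal2000.eulerDepleteTableList` from `Literature/…/GreenbergVatsal2000/EulerFactorDepletion.lean`
(p605172, reviewed) and a landed statement file's import header is not widened for one declaration; same namespace
`Summit.BirchSwinnertonDyer.Rank1Residual.F1Sign2`, so the consumer adds one import and uses the name.

TYPER FILING (seat `bsd-f1-sign2-ty` g7; CANDIDATES.md row IMC-SYMB-Σ(sym) — the symbol-level form of IMC-SYMB-Σ(RawS3)). CONSUMER ASK (seat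
bsd-line-att-p1 g3, LEAD of crux C1 `MainConjectureTransportAlignedAtTwo` = stmt-BirchSwinnertonDyer-22296, route AlignedTransportAtTwo;
HOME/INBOX.md 2026-08-28T04:30:29Z, corrected 04:32:25Z («MUST carry `l.Nodup →`»), unblocked 04:40:44Z after **p605172** + **p605340** ACCEPTED):
«file `@[conjecture] def SigmaDepletedSymbolParityAtTwoS3 : Prop :=` body = the `hparS` binder of the LANDED
`…Theorems.AlignedTransportAtTwoSigmaSymbolParity.sigmaRawS3_of_sigmaSymbolParity`, incl. `l.Nodup →`». BODY = that binder VERBATIM, extracted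
mechanically from the tree file `Theorems/AlignedTransportAtTwoMainConjectureTransportAlignedAtTwoSigmaSymbolParity.lean` (sha16 0c443bc9deb45b15) and
asserted token-identical to the registered inline stub `stub_sigmaSymbolParity` of skeleton v8
`Cruxes/MainConjectureTransportAlignedAtTwo/Lines/birth.lean` (sha16 307a4992ab59548f) — so v9 re-points that stub BY NAME
(`F1Sign2.SigmaDepletedSymbolParityAtTwoS3`), exactly as v5 ↦ `…SigmaRS3` (p594870) and v7 ↦ `…SigmaRawS3` (-ty g6) did. POSITION IN THE TREE (all
kernel-checked there, none of it restated here): `SigmaDepletedSymbolParityAtTwoS3` ⇒ `SymbolLineTransferAtTwoSigmaRawS3`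
(`…SigmaSymbolParity.sigmaRawS3_of_sigmaSymbolParity`, p605340 — through `red_depleted_eq_of_sigmaSymbolParity`: the two `Σ`-depleted
Mazur–Swinnerton-Dyer measures have transforms `ι(∏𝒫_v^ι(Wᵢ))·L₂(fᵢ,αᵢ)` EXACTLY by `GreenbergVatsal2000.eulerDepleteList_spec`, differ by an EVEN
`ℤ₂`-valued distribution when the tables are congruent, and an even distribution bounded by `1` has transform in `2Λ` at `p = 2`), and RawS3 +
Kato 2004 Thm 17.4 (1)(2) at `2` + modularity + the period unit at `2` + Matsuno 2008 Thm 4.2 ⇒ C1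
(`…SigmaSymbolParity.mainConjectureTransportAlignedAtTwo_of_sigmaSymbolParity`). The glue RawS3 ⟸ (this law) is NOT restated in this file: it
needs the `BirchSwinnertonDyer/BirchSwinnertonDyer/Theorems` side, which imports this module's sibling (an in-file proof would close an import
cycle) — REF1 §68's structural note for RawS3 applies verbatim. REF1-AUDIT-v1 §71 (2026-08-28T05:15:12Z, file 5581b31f40e7cbd1; evidence `HOME/REF1-data/b71/` Probe_V8.lean rc 0,
stubdiff.txt): **SURVIVES, conjecture-grade; CLEARED for -ty** — A1 token-identical to `hparS` (1 062 chars, 11 ∀, 17 →; kernel `exact`); A2 read-back of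
the tail symbol by symbol (tables `½ℤ₍₂₎`-valued via the odd Eisenstein multiple, so the law compares `2Φ₁ ≡ 2Φ₂ (mod 2)`: genuine, not automatic);
A3 inhabited (194 good-ordinary ALIGNED S₃ instances N ≤ 30 000, D9B-VERDICT; degenerate `W₁ = W₂` true); A4 junk-safe (junk `0` tables give a true
conclusion; `l.Nodup` ENDORSED and load-bearing: at a cross-type place `P_ℓ(W₁) ≡ (1+X)²` vs `P_ℓ(W₂) ≡ 1+X` mod 2); A5 mutation: drop `AlignedAtTwo`
⇒ FALSE (431a1 ~ 431b1, m = 6; misaligned-at-2 NEQ 5 844), drop `AlignedAtInfinity` ⇒ FALSE (NEQ 369), drop `¬ IsSquare Δ` ⇒ a different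
statement (three matchings), strengthen to `‖·‖ ≤ ½` ⇒ FALSE; A6: EPW fix an ODD prime, «p-distinguished» is VOID at 2 and mod-2 multiplicity one
FAILS on the ON stratum {2 totally split in ℚ(W[2])} (Kilford 2002: 431, 503, 2089 non-Gorenstein) — so NO specialisation of EPW's printed theorem
yields this law: it is a NEW conjecture SHAPED LIKE EPW, EPW cited for the shape only (R2-G44); NEW STRUCTURAL REMARK: `AlignedAtTwo` is AUTOMATIC
unless 2 splits completely in `F` (the canonical subgroup pins one root on each side when `ρ̄(G_{ℚ₂}) = C₂`), so the hypothesis is informative exactly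
on the ON stratum = Kilford's locus, where the census reads aligned ⇒ EQUAL 2 337/2 337 decisive at m = 6 (0 decisive failures), good/good aligned
194/194, and misaligned same-level Kilford pairs FAIL (431a1 ~ 431b1 λ 6 vs 2; 503a/b/c; 2089a1 ~ c1/d1/e1); BC7 CLEAN (P1 32.8 s / P2 7.7 / P2h 3.0 /
P3 44.5); cheapest falsifiers NOT yet run (for -imc, -data, D9B-VERDICT numbers): (F1) the 37 Δ > 0 «c3-ambiguous» pairs (the typed alignment
predicates are unambiguous — evaluate and run xsym at m = 6), (F2) the 24 aligned instances with λ ≥ 16 reading NEQ/ZERO at m = 6 beyond resolution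
(3807a1 ~ 7614i1/j1 ~ 19035e1, 7263a1 ~ 14526a1/b1, 21282j1 ~ k1, 27582b1 ~ f1, 27794a1 ~ e1, 29241a1 ~ b1; need m ≥ 8), (F3) the k = 0 row
(L-values) on the 194 aligned good/good pairs. REF2: Emerton–Pollack–Weston
2006 fix «an odd prime p» and derive the congruence of `Σ`-depleted eigensymbols (Thm. 3.6.2, §4 Cor. 4.3.3) from mod-`p` MULTIPLICITY ONE; the
`p = 2` law with «multiplicity one» replaced by «aligned at `2` and at `∞`» is NOT in print (REF2 v16 placement of the EPW rows; -ref2 g16 slot read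
pending) — WHY NOVEL: it is the cell's own symbol-level reformulation of the line-transfer law at `2`, where EPW's mechanism has no published
analogue (no mod-`2` multiplicity one; the alignment datum replaces it). CENSUS / BC5 (att-p1 g3; MEMO-imc D-imc-7/8/9, XSYM object
`Ē₁ψ̄₁ = Ē₂ψ̄₂` with `(σ_ℓ⁻¹ψ)(a) = ψ(ℓa)` = the depleted mod-`2` plus symbols of the pair): aligned ⇒ equal on **105/105 + 2 180/2 180 + 1 201/1 201**
decisive instances; misaligned ⟺ different copy 84/84 (dropping either alignment clause is census-refuted). CHEAPEST FALSIFIER: one aligned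
good-ordinary `S₃` pair, one admissible duplicate-free `l`, one cusp `m/2ᵏ` with `Φ₁ − Φ₂ ∉ ℤ₍₂₎` — a finite exact computation per instance
(tables `eulerDepleteTableList W l [·]⁺_f`), and a kernel certificate of any census row would be a theorem instance (att-p1 g3). WHY IT MIGHT FAIL:
a `2`-adic NON-unit ratio between the canonical (EPW) period and the tree's plus-symbol normalisation `ratPlusSymbol` on one side of an aligned
pair (unit ratios are harmless: `u ≡ 1 mod 2` and `‖Φ‖₂ ≤ 2` give `‖(u−1)Φ‖₂ ≤ 1`), or a failure of «aligned ⇒ same copy» beyond the census range.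
Nothing asserted; no `sorry`; no Literature debt; net debt delta 0. PARTITION: none moved; beyond-print theorem: no (C1 stays OPEN modulo this law
+ 4 PRINT; BSD is not proved). bears_on: `stmt-BirchSwinnertonDyer-22296` (C1 of route AlignedTransportAtTwo: skeleton v8 `stub_sigmaSymbolParity` →
BY NAME).
-/

noncomputable section

open scoped Classical MatrixGroups ModularForm
open CongruenceSubgroup Polynomial
open Literature.NumberTheory.EllipticCurves Literature.NumberTheory.EllipticCurves.ModularForms
open Literature.NumberTheory.EllipticCurves.Greenberg1999
open Literature.NumberTheory.EllipticCurves.GreenbergVatsal2000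
open Literature.NumberTheory.EllipticCurves.Rank1Residual
open Summit.BirchSwinnertonDyer.Rank1Residual.X1.MuLambda
open Summit.BirchSwinnertonDyer.Rank1Residual.X5
open IsDedekindDomain NumberField

set_option autoImplicit false

namespace Summit.BirchSwinnertonDyer.Rank1Residual.F1Sign2

/-- **Candidate `SigmaDepletedSymbolParityAtTwoS3` (IMC-SYMB-Σ at the level of RATIONAL MODULAR SYMBOLS — the Σ-symbol parity law; OPEN
obligation — a conjecture of ours, NOT a published result).** For every pair of globally minimal curves `W₁, W₂ / ℚ`, both GOOD ORDINARY at `2`,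
both without rational `2`-torsion, both of non-square discriminant (mod-`2` image `S₃`), sharing a cubic number field `F` generated by roots
`e₁, e₂` of their `u`-cubics that are ALIGNED at `2` and at `∞`, for every pair of newforms `f₁, f₂` attached to them, and for every DUPLICATE-FREE
list `l` of places of ODD residue characteristic containing a place above each odd prime of `N₁N₂` (a finite set `Σ` of odd places in some order;
the depleted table does not depend on the order), the `Σ`-DEPLETED PLUS-SYMBOL TABLES
`Φᵢ = eulerDepleteTableList Wᵢ l [·]⁺_{fᵢ} = (∏_{v∈l} P_v(Wᵢ, ℓ_v⁻¹[ℓ_v])) [·]⁺_{fᵢ}` (`(φ|[d])(x) = φ(dx)`, `P_v(W, X)` the local polynomial of `W`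
at `v`; EPW §3 (3.4)–(3.5): `{∞, x}_{f(ℓ·)} = ℓ⁻¹{∞, ℓx}_f`) are `2`-INTEGRALLY CONGRUENT ON THE `2`-POWER CUSPS:
`Φ₁(m/2ᵏ) − Φ₂(m/2ᵏ) ∈ ℤ₍₂₎` for all `m, k` (the half-integers `2Φ` agree mod `2`), written `‖(Φ₁(m/2ᵏ) − Φ₂(m/2ᵏ) : ℚ_[2])‖ ≤ 1`.
A NEW conjecture of the cell SHAPED LIKE Emerton–Pollack–Weston's «congruence of `Σ`-depleted eigensymbols» (their Thm. 3.6.2 / §4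
Cor. 4.3.3 is printed for an ODD prime under mod-`p` multiplicity one; at `2` «`p`-distinguished» is void and multiplicity one FAILS on the ON stratum
{`2` totally split in `ℚ(W[2])`} by Kilford 2002 — so no specialisation of EPW yields this law; EPW is cited for the SHAPE ONLY, REF1 §71 / R2-G44);
the alignment datum (the cell's MULT2/CA currency) stands where EPW have multiplicity one, and `AlignedAtTwo` is automatic off the ON stratum
(REF1 §71 (vi)), so the law is informative exactly on Kilford's locus. BODY = the `hparS` binder of `…Theorems.AlignedTransportAtTwoSigmaSymbolParity.sigmaRawS3_of_sigmaSymbolParity` (p605340) VERBATIM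
(= skeleton v8's inline `stub_sigmaSymbolParity`). POSITION (tree-proved there): this law ⇒ `SymbolLineTransferAtTwoSigmaRawS3` (without even using
RawS3's clause `red G₁ ≠ 0`) ⇒, with four published facts, C1. Read-back versus `SymbolLineTransferAtTwoSigmaRawS3`: same binders through the two
newforms; then NO lifts `G₁, G₂` and no `red G₁ ≠ 0` (the statement is about rational numbers, below the `2`-adic `L`-functions), the finite set `S`
is replaced by a duplicate-free LIST `l` with the same two admissibility clauses, and the conclusion is the cusp-by-cusp `2`-integrality of
`Φ₁ − Φ₂`. MUTATION: dropping `l.Nodup` is census-false (a repeated place depletes twice by the curve-dependent `P_v(Wᵢ)`; `ℓ = 5` in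
`503c1 ~ 5030c1`); dropping `AlignedAtTwo` or `AlignedAtInfinity` is census-refuted (misaligned ⟺ different copy, 84/84); extra good places in `l`
are harmless. CENSUS / BC5 (files `MEMO-imc-data/dimc9b/j286212/{D9B-VERDICT,ALIGN3-SUMMARY,XSYM9-m6,SYMTEST9}.txt`, `dimc7/{XSYM-census-m6,SYMTEST-census}.txt`):
XSYM 105/105 + 2 180/2 180 + 1 201/1 201 (aligned ⇒ equal depleted mod-`2` symbols); REF1 §71's reading of the same files on this law's own stratum:
aligned ⇒ EQUAL 2 337/2 337 decisive at `m = 6`, good-ordinary/good-ordinary aligned 194/194, rank-0 seed ~ rank-1 target 20/20. WHY IT MIGHT FAIL: a `2`-adic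
non-unit ratio between EPW's canonical period and the `ratPlusSymbol` normalisation on one side of an aligned pair, or «aligned ⇒ same copy»
failing beyond the census range. Consumer: crux C1 stmt-BirchSwinnertonDyer-22296, line `birth` v8, stub `stub_sigmaSymbolParity` BY NAME. Nothing
asserted. [cite: EmertonPollackWeston2006, §3 (3.4)–(3.5) (depleted symbols) and Thm. 3.6.2 / §4 Cor. 4.3.3 (SHAPE ONLY: printed for odd p under mod-p multiplicity one)]
[cite: Kilford2002, §1 (mod 2 multiplicity one fails at N = 431, 503, 2089)] [cite: GreenbergVatsal2000, §1 (8)–(10), Prop. (2.4)]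
[cite: MazurTateTeitelbaum1986Invent, §I.10–I.13] -/
@[conjecture] def SigmaDepletedSymbolParityAtTwoS3 : Prop :=
  ∀ (W₁ : WeierstrassCurve ℚ) [W₁.IsElliptic] [W₁.IsGloballyMinimal]
    (W₂ : WeierstrassCurve ℚ) [W₂.IsElliptic] [W₂.IsGloballyMinimal],
    IsOrdinaryAt W₁ 2 → IsOrdinaryAt W₂ 2 →
    (∀ x : ℚ, ¬ HasRationalTwoTorsionX W₁ x) → (∀ x : ℚ, ¬ HasRationalTwoTorsionX W₂ x) →
    ¬ IsSquare W₁.Δ → ¬ IsSquare W₂.Δ →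
    ∀ (F : Type) [Field F] [NumberField F], Module.finrank ℚ F = 3 →
    ∀ e₁ e₂ : F, aeval e₁ (twoDivisionUCubic W₁) = 0 → aeval e₂ (twoDivisionUCubic W₂) = 0 →
    AlignedAtTwo F e₁ e₂ → AlignedAtInfinity F (twoDivisionUCubic W₁) (twoDivisionUCubic W₂) e₁ e₂ →
    ∀ ⦃N₁ : ℕ⦄ [NeZero N₁] (f₁ : CuspForm (Gamma0 N₁) 2), IsNewformOf W₁ f₁ →
    ∀ ⦃N₂ : ℕ⦄ [NeZero N₂] (f₂ : CuspForm (Gamma0 N₂) 2), IsNewformOf W₂ f₂ →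
    ∀ l : List (HeightOneSpectrum (𝓞 ℚ)), l.Nodup →
      (∀ v ∈ l, Rat.HeightOneSpectrum.natGenerator v ≠ 2) →
      (∀ ℓ ∈ (N₁ * N₂).primeFactors, ℓ ≠ 2 → ∃ v ∈ l, Rat.HeightOneSpectrum.natGenerator v = ℓ) →
      ∀ m k : ℕ,
        ‖((eulerDepleteTableList W₁ l (ratPlusSymbol f₁) ((m : ℚ) / (2 : ℚ) ^ k) -
            eulerDepleteTableList W₂ l (ratPlusSymbol f₂) ((m : ℚ) / (2 : ℚ) ^ k) : ℚ) : ℚ_[2])‖ ≤ 1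

end Summit.BirchSwinnertonDyer.Rank1Residual.F1Sign2

end
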